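import Summits.ValiantsHypothesis.ValiantsHypothesis.Theorems.BarrierLeverDescentCertificateSufficesBlocks

/-!
# Route BarrierLever — item `TransversalTwinFreeReduction` (R2, stmt-ValiantsHypothesis-19588),
# PROVED by a LITERAL-BLOCK LIFT

Closing file (`--workitem stmt-ValiantsHypothesis-19588`; cell valiant-natproofs, rung V4, 𝒟-side;
prover seat val-np-p1; item typed by planner p1-g10). Conventions are those of item
`TransversalMinorLayoutsNonsingular` (TT, stmt-19152): row literals `ρ_x b = castAdd b` if `b ∈ x`
else `natAdd b`, column literals `κ_y d = natAdd d` if `d ∈ y` else `castAdd d`,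
`Θ_H[x, y] = det H[ρ_x, κ_y]`; a layout `(u, w)` is GOOD when some `H` makes the layout matrix
`(Θ_H[u_i, w_j])_{i,j}` nonsingular. For coordinates `a`, `c` of `Fin (h+1)` the PROJECTED layout
one dimension down is `u'_i = {b : Fin h | a.succAbove b ∈ u_i}`,
`w'_j = {b | c.succAbove b ∈ w_j}`.

**The literal-block lift (§1–§2).** For `H' : Matrix (Fin (h+h)) (Fin (h+h)) ℂ` and a table
`Z : Bool → Bool → ℂ` define `lift a c H' Z : Matrix (Fin (2h+2)) (Fin (2h+2)) ℂ` by: `Z β γ` on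
(literal `(a, β)`) × (literal `(c, γ)`); `0` on (literals of `a`) × (literals of coordinates `≠ c`)
and on (literals of coordinates `≠ a`) × (literals of `c`); `H'` (re-indexed along `a.succAbove`,
`c.succAbove`) elsewhere. In the minor `lift[ρ_x, κ_y]` (indexed by coordinates) the row of `a`
has the single entry `Z x_a y_c` in the column of `c`, and that column is otherwise `0`; Laplace
expansion along that row (`Matrix.det_succ_row`) gives the LIFT FORMULA (`det_lift_submatrix`)
`Θ_{lift}[x, y] = (−1)^{a+c} · Z x_a y_c · Θ_{H'}[x', y']`.

**R2 (§3, `transversalTwinFreeReduction`, signature VERBATIM).** With `Z ≡ 1` the layout matrix of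
`(u, w)` for `lift a c H' 1` is `(−1)^{a+c}` times the layout matrix of the projected layout for
`H'`, so GOOD(projected) ⇒ GOOD(u, w). The item's twin-free hypotheses (both coordinate deletions
injective) are NOT used: they only make the hypothesis GOOD(projected) satisfiable (a projected
layout with a repeated row point has a singular layout matrix for every `H'`).

WHAT THIS IS NOT: a reduction step (one of the planner's two algebraic reductions R1/R2 cutting TT
down to its irreducible core, item 19616); nothing on the core, on TT / TNS / item 19717 in
general, on crux stmt-ValiantsHypothesis-14610, or on `VP` versus `VNP`.
-/

-- layout Summits/ValiantsHypothesis/ValiantsHypothesis forces the duplicated namespace component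
set_option linter.dupNamespace false

namespace Summit.ValiantsHypothesis.ValiantsHypothesis.Theorems.BarrierLever.LiteralLift

open Finset
open Summit.ValiantsHypothesis.ValiantsHypothesis.Theorems.BarrierLever.NearPrincipal
open Summit.ValiantsHypothesis.ValiantsHypothesis.Theorems.BarrierLever.Descent (rowL colL
  rowDec_rowL colDec_colL)

variable {h : ℕ}

/-! ## 1. Literal encodings and the lift -/

/-- Row literal of (coordinate, bit): bit `true` (the coordinate is IN the row point) ↦ `castAdd`,
bit `false` ↦ `natAdd`. -/
def rowLit (b : Fin h) (β : Bool) : Fin (h + h) :=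
  if β = true then Fin.castAdd h b else Fin.natAdd h b

/-- Column literal of (coordinate, bit): bit `true` (the coordinate is IN the column point)
↦ `natAdd`, bit `false` ↦ `castAdd`. -/
def colLit (d : Fin h) (γ : Bool) : Fin (h + h) :=
  if γ = true then Fin.natAdd h d else Fin.castAdd h d

/-- `rowLit` reproduces the row literals of a point. -/
theorem rowLit_decide (x : Finset (Fin h)) (b : Fin h) : rowLit b (decide (b ∈ x)) = rowL x b := by
  unfold rowLit rowL
  by_cases hb : b ∈ x
  · rw [decide_eq_true hb, if_pos rfl, if_pos hb]
  · rw [decide_eq_false hb, if_neg (by decide), if_neg hb]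

/-- `colLit` reproduces the column literals of a point. -/
theorem colLit_decide (y : Finset (Fin h)) (d : Fin h) : colLit d (decide (d ∈ y)) = colL y d := by
  unfold colLit colL
  by_cases hd : d ∈ y
  · rw [decide_eq_true hd, if_pos rfl, if_pos hd]
  · rw [decide_eq_false hd, if_neg (by decide), if_neg hd]

/-- THE LITERAL-BLOCK LIFT of `H' : Matrix (Fin (h+h)) (Fin (h+h)) ℂ` along the coordinates `a`
(rows) and `c` (columns) with the `2 × 2` table `Z` on (literals of `a`) × (literals of `c`):
zero cross blocks, `H'` re-indexed by `a.succAbove` / `c.succAbove` elsewhere. -/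
noncomputable def lift (a c : Fin (h + 1)) (H' : Matrix (Fin (h + h)) (Fin (h + h)) ℂ)
    (Z : Bool → Bool → ℂ) : Matrix (Fin ((h + 1) + (h + 1))) (Fin ((h + 1) + (h + 1))) ℂ :=
  fun p q =>
    if hx : (rowDec p).1 = a then (if (colDec q).1 = c then Z (rowDec p).2 (colDec q).2 else 0)
    else if hy : (colDec q).1 = c then 0
    else H' (rowLit (Classical.choose (Fin.exists_succAbove_eq hx)) (rowDec p).2)
      (colLit (Classical.choose (Fin.exists_succAbove_eq hy)) (colDec q).2)

/-- The lift on (literal of `a`) × (any column literal). -/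
theorem lift_row_a (a c : Fin (h + 1)) (H' : Matrix (Fin (h + h)) (Fin (h + h)) ℂ)
    (Z : Bool → Bool → ℂ) (x y : Finset (Fin (h + 1))) (d : Fin (h + 1)) :
    lift a c H' Z (rowL x a) (colL y d) =
      if d = c then Z (decide (a ∈ x)) (decide (d ∈ y)) else 0 := by
  have h1 : (rowDec (rowL x a)).1 = a := by rw [rowDec_rowL]
  unfold lift
  rw [dif_pos h1, rowDec_rowL, colDec_colL]

/-- The lift off the literals of `a` and `c`: the re-indexed `H'`. -/
theorem lift_succAbove (a c : Fin (h + 1)) (H' : Matrix (Fin (h + h)) (Fin (h + h)) ℂ)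
    (Z : Bool → Bool → ℂ) (x y : Finset (Fin (h + 1))) (b d : Fin h) :
    lift a c H' Z (rowL x (a.succAbove b)) (colL y (c.succAbove d)) =
      H' (rowLit b (decide (a.succAbove b ∈ x))) (colLit d (decide (c.succAbove d ∈ y))) := by
  have h1 : ¬ (rowDec (rowL x (a.succAbove b))).1 = a := by
    rw [rowDec_rowL]; exact Fin.succAbove_ne a b
  have h2 : ¬ (colDec (colL y (c.succAbove d))).1 = c := by
    rw [colDec_colL]; exact Fin.succAbove_ne c d
  have hb : Classical.choose (Fin.exists_succAbove_eq h1) = b := by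
    apply Fin.succAbove_right_injective (p := a)
    have := Classical.choose_spec (Fin.exists_succAbove_eq h1)
    rw [this, rowDec_rowL]
  have hd : Classical.choose (Fin.exists_succAbove_eq h2) = d := by
    apply Fin.succAbove_right_injective (p := c)
    have := Classical.choose_spec (Fin.exists_succAbove_eq h2)
    rw [this, colDec_colL]
  unfold lift
  rw [dif_neg h1, dif_neg h2, hb, hd, rowDec_rowL, colDec_colL]

/-! ## 2. The lift formula -/

/-- Row literals of the projected point are the `rowLit`-encodings. -/
theorem rowL_proj (a : Fin (h + 1)) (x : Finset (Fin (h + 1))) (b : Fin h) :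
    rowL (univ.filter (fun b : Fin h => a.succAbove b ∈ x)) b =
      rowLit b (decide (a.succAbove b ∈ x)) := by
  unfold rowL rowLit
  by_cases hb : a.succAbove b ∈ x
  · have hm : b ∈ univ.filter (fun b : Fin h => a.succAbove b ∈ x) :=
      mem_filter.mpr ⟨mem_univ _, hb⟩
    rw [if_pos hm, decide_eq_true hb, if_pos rfl]
  · have hm : b ∉ univ.filter (fun b : Fin h => a.succAbove b ∈ x) :=
      fun h' => hb (mem_filter.mp h').2
    rw [if_neg hm, decide_eq_false hb, if_neg (by decide)]

/-- Column literals of the projected point are the `colLit`-encodings. -/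
theorem colL_proj (c : Fin (h + 1)) (y : Finset (Fin (h + 1))) (d : Fin h) :
    colL (univ.filter (fun b : Fin h => c.succAbove b ∈ y)) d =
      colLit d (decide (c.succAbove d ∈ y)) := by
  unfold colL colLit
  by_cases hd : c.succAbove d ∈ y
  · have hm : d ∈ univ.filter (fun b : Fin h => c.succAbove b ∈ y) :=
      mem_filter.mpr ⟨mem_univ _, hd⟩
    rw [if_pos hm, decide_eq_true hd, if_pos rfl]
  · have hm : d ∉ univ.filter (fun b : Fin h => c.succAbove b ∈ y) :=
      fun h' => hd (mem_filter.mp h').2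
    rw [if_neg hm, decide_eq_false hd, if_neg (by decide)]

/-- **THE LIFT FORMULA.** The transversal minor of the lift on the block `(x, y)` is
`(−1)^{a+c} · Z x_a y_c ·` the transversal minor of `H'` on the projected block. -/
theorem det_lift_submatrix (a c : Fin (h + 1)) (H' : Matrix (Fin (h + h)) (Fin (h + h)) ℂ)
    (Z : Bool → Bool → ℂ) (x y : Finset (Fin (h + 1))) :
    ((lift a c H' Z).submatrix (rowL x) (colL y)).det =
      (-1) ^ ((a : ℕ) + (c : ℕ)) * Z (decide (a ∈ x)) (decide (c ∈ y)) *
        (H'.submatrix (rowL (univ.filter (fun b : Fin h => a.succAbove b ∈ x)))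
          (colL (univ.filter (fun b : Fin h => c.succAbove b ∈ y)))).det := by
  rw [Matrix.det_succ_row _ a, Finset.sum_eq_single c]
  · congr 1
    · rw [Matrix.submatrix_apply, lift_row_a, if_pos rfl]
    · congr 1
      ext b d
      simp only [Matrix.submatrix_apply]
      rw [lift_succAbove, rowL_proj, colL_proj]
  · intro d _ hdc
    rw [Matrix.submatrix_apply, lift_row_a, if_neg hdc, mul_zero, zero_mul]
  · intro hc
    exact absurd (mem_univ c) hc

/-- The lift formula for the all-ones table: `Θ_{lift}[x, y] = (−1)^{a+c} Θ_{H'}[x', y']`. -/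
theorem det_lift_one_submatrix (a c : Fin (h + 1)) (H' : Matrix (Fin (h + h)) (Fin (h + h)) ℂ)
    (x y : Finset (Fin (h + 1))) :
    ((lift a c H' (fun _ _ => 1)).submatrix (rowL x) (colL y)).det =
      (-1) ^ ((a : ℕ) + (c : ℕ)) *
        (H'.submatrix (rowL (univ.filter (fun b : Fin h => a.succAbove b ∈ x)))
          (colL (univ.filter (fun b : Fin h => c.succAbove b ∈ y)))).det := by
  rw [det_lift_submatrix, mul_one]

/-! ## 3. R2: the item, verbatim -/

/-- **Item stmt-ValiantsHypothesis-19588 `TransversalTwinFreeReduction` (R2), signature VERBATIM.**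
If the projected layout (delete coordinate `a` on the rows, `c` on the columns) is GOOD, the layout
is GOOD: the layout matrix of `lift a c H' 1` is `(−1)^{a+c}` times the projected layout matrix
of `H'` (`det_lift_one_submatrix`). The twin-free hypotheses are not used. -/
theorem transversalTwinFreeReduction :
    ∀ (h r : ℕ) (u w : Fin r → Finset (Fin (h + 1))) (a c : Fin (h + 1)),
    Function.Injective (fun i => Finset.univ.filter fun b : Fin h => a.succAbove b ∈ u i) →
    Function.Injective (fun j => Finset.univ.filter fun b : Fin h => c.succAbove b ∈ w j) →
    (∃ H : Matrix (Fin (h + h)) (Fin (h + h)) ℂ, (Matrix.of fun i j : Fin r =>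
      (H.submatrix
        (fun b : Fin h => if b ∈ (Finset.univ.filter fun b : Fin h => a.succAbove b ∈ u i)
          then Fin.castAdd h b else Fin.natAdd h b)
        (fun b : Fin h => if b ∈ (Finset.univ.filter fun b : Fin h => c.succAbove b ∈ w j)
          then Fin.natAdd h b else Fin.castAdd h b)).det).det ≠ 0) →
    ∃ H : Matrix (Fin ((h + 1) + (h + 1))) (Fin ((h + 1) + (h + 1))) ℂ,
      (Matrix.of fun i j : Fin r =>
        (H.submatrix (fun b : Fin (h + 1) => if b ∈ u i then Fin.castAdd (h + 1) b
            else Fin.natAdd (h + 1) b)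
          (fun b : Fin (h + 1) => if b ∈ w j then Fin.natAdd (h + 1) b
            else Fin.castAdd (h + 1) b)).det).det ≠ 0 := by
  intro h r u w a c _ _ hgood
  obtain ⟨H', hH'⟩ := hgood
  refine ⟨lift a c H' (fun _ _ => 1), ?_⟩
  have hM : (Matrix.of fun i j : Fin r =>
      ((lift a c H' (fun _ _ => 1)).submatrix (fun b : Fin (h + 1) => if b ∈ u i then
          Fin.castAdd (h + 1) b else Fin.natAdd (h + 1) b)
        (fun b : Fin (h + 1) => if b ∈ w j then Fin.natAdd (h + 1) b
          else Fin.castAdd (h + 1) b)).det) =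
      ((-1 : ℂ) ^ ((a : ℕ) + (c : ℕ))) • (Matrix.of fun i j : Fin r =>
        (H'.submatrix
          (fun b : Fin h => if b ∈ (Finset.univ.filter fun b : Fin h => a.succAbove b ∈ u i)
            then Fin.castAdd h b else Fin.natAdd h b)
          (fun b : Fin h => if b ∈ (Finset.univ.filter fun b : Fin h => c.succAbove b ∈ w j)
            then Fin.natAdd h b else Fin.castAdd h b)).det) := by
    ext i j
    simp only [Matrix.of_apply, Matrix.smul_apply, smul_eq_mul]
    exact det_lift_one_submatrix a c H' (u i) (w j)
  rw [hM, Matrix.det_smul]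
  exact mul_ne_zero (pow_ne_zero _ (pow_ne_zero _ (neg_ne_zero.mpr one_ne_zero))) hH'

/-- **R2 without side conditions** (the form to USE): for every layout `(u, w)` in dimension
`h + 1` and every pair of coordinates `a`, `c`, GOOD(projected layout: delete `a` on the rows, `c`
on the columns) ⇒ GOOD(`u`, `w`) — no injectivity (twin-freeness) hypothesis is needed, the
hypothesis GOOD(projected) is simply unsatisfiable when a deletion identifies two points. -/
theorem good_of_good_proj (h r : ℕ) (u w : Fin r → Finset (Fin (h + 1))) (a c : Fin (h + 1))
    (hgood : ∃ H : Matrix (Fin (h + h)) (Fin (h + h)) ℂ, (Matrix.of fun i j : Fin r =>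
      (H.submatrix
        (fun b : Fin h => if b ∈ (Finset.univ.filter fun b : Fin h => a.succAbove b ∈ u i)
          then Fin.castAdd h b else Fin.natAdd h b)
        (fun b : Fin h => if b ∈ (Finset.univ.filter fun b : Fin h => c.succAbove b ∈ w j)
          then Fin.natAdd h b else Fin.castAdd h b)).det).det ≠ 0) :
    ∃ H : Matrix (Fin ((h + 1) + (h + 1))) (Fin ((h + 1) + (h + 1))) ℂ,
      (Matrix.of fun i j : Fin r =>
        (H.submatrix (fun b : Fin (h + 1) => if b ∈ u i then Fin.castAdd (h + 1) b
            else Fin.natAdd (h + 1) b)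
          (fun b : Fin (h + 1) => if b ∈ w j then Fin.natAdd (h + 1) b
            else Fin.castAdd (h + 1) b)).det).det ≠ 0 := by
  obtain ⟨H', hH'⟩ := hgood
  refine ⟨lift a c H' (fun _ _ => 1), ?_⟩
  have hM : (Matrix.of fun i j : Fin r =>
      ((lift a c H' (fun _ _ => 1)).submatrix (fun b : Fin (h + 1) => if b ∈ u i then
          Fin.castAdd (h + 1) b else Fin.natAdd (h + 1) b)
        (fun b : Fin (h + 1) => if b ∈ w j then Fin.natAdd (h + 1) b
          else Fin.castAdd (h + 1) b)).det) =
      ((-1 : ℂ) ^ ((a : ℕ) + (c : ℕ))) • (Matrix.of fun i j : Fin r =>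
        (H'.submatrix
          (fun b : Fin h => if b ∈ (Finset.univ.filter fun b : Fin h => a.succAbove b ∈ u i)
            then Fin.castAdd h b else Fin.natAdd h b)
          (fun b : Fin h => if b ∈ (Finset.univ.filter fun b : Fin h => c.succAbove b ∈ w j)
            then Fin.natAdd h b else Fin.castAdd h b)).det) := by
    ext i j
    simp only [Matrix.of_apply, Matrix.smul_apply, smul_eq_mul]
    exact det_lift_one_submatrix a c H' (u i) (w j)
  rw [hM, Matrix.det_smul]
  exact mul_ne_zero (pow_ne_zero _ (pow_ne_zero _ (neg_ne_zero.mpr one_ne_zero))) hH'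

end Summit.ValiantsHypothesis.ValiantsHypothesis.Theorems.BarrierLever.LiteralLift
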